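import Literature.MathematicalPhysics.QuantumFieldTheory.Balaban1983to89.B8Ineq145Lineage
import Literature.MathematicalPhysics.QuantumFieldTheory.Balaban1983to89.B8Eq184Proof

/-!
# `Balaban1983to89.B7GaugeFixingPureGauge` — [Balaban1985Averaging] Sect. C's gauge fixing (76)–(77), (81), (85), (87) of DEPTH 1 AND 2, EVALUATED on a
# PURE GAUGE `U₁ = g·1·g⁻¹` at the flat background `U₀ = 1`, abelian scalar model `𝔸 = ℂ`, `g = e^{iψ}`: the frames `w₁`, `w₂`, the gauge fixings `glev₁`, `glev₂`
# in closed form, and THE TRANSITION FUNCTION OF THE GAUGE-FIXED FIELD BETWEEN A DEPTH-2 TOWER AND A DEPTH-1 TOWER: `e^{i(M₂ψ − M₁ψ)}` (difference of the two tower MEANS)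

statement-level skeleton of published theorems with citation tags; proofs where landed; nothing here is a claim about the Yang–Mills mass gap

T. Bałaban, *Averaging operations for lattice gauge theories*, Commun. Math. Phys. **98** (1985) 17–51 `[Balaban1985Averaging]` ("[3]"; journal page = PDF
page + 16): (8)–(9) p. 18–19 (parallel transport, gauge action), (42)–(43) pp. 23–24 (block average, iterated), (55) p. 27 (moving frame), (58) p. 27
(twisted transport), (70)–(71) p. 29 (covariance of the `j`-fold objects), (76)–(78) pp. 29–30 (solved axial gauge condition, site average),
(79)–(81) p. 30 (averaging of gauge transformations, averaging condition), (82) p. 30, (85) p. 31 (the frames `\overline{R_{0,·}U₁}^{(j)}`), (87) p. 31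
(`u = (\overline{R_{0,·}U₁}^{(k)})⁻¹` on `Ω^{(k)}`).  T. Bałaban, *Spaces of regular gauge field configurations on a lattice and gauge fixing conditions*,
Commun. Math. Phys. **99** (1985) 75–102 `[Balaban1985RegularSpaces]` ("B8"): Prop. 7 p. 100 («a gauge transformation u satisfying (1.29) and such that
the configuration U′ = (U₁U₀)^u U₀⁻¹ satisfies the axial gauge conditions (1.19). This gauge transformation is determined uniquely.»), (1.5)–(1.6) p. 77.

## WHY THIS FILE (cell `pub-ymgap`, HUMAN RULING D-0062 ∕ D-0149 ∕ D-0154; N05 = [B8]; width seat `pub-ymgap-dag-n05-w5` g3, CLAIM-2 of 2026-08-28T08:07Z)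

The N05 lineage's P₇-currency certificates (`B8Ineq145Lineage`, `B8Prop7PrintedRZdGF3P2HalfSpace(AllL∕CStar)`: the printed constant `2α₂` of
[Balaban1985RegularSpaces] (1.145) fails for print's pinned tower-wise map) all use ONE witness: the CONSTANT configuration `U₁ ≡ e^{iθ}` at a
`∂Λ₁`-CROSSING bond of a one-step geometry, where the gauge fixing is [3]'s `glev` of depth 1 on one side and `1` on the other.  The box-form reading
of (1.145) (NODE 00's carrier `zdGF3.avgClose`: both `j`-blocks in `Ω_j`) excludes those bonds; its inter-tower bonds sit between towers of depths `J`
and `J − 1 ≥ 1`, where BOTH sides carry [3]'s gauge fixing — of different depths.  For that one needs [3]'s objects evaluated on a general PURE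
GAUGE `U₁ = dg` (a potential `ψ`, not a constant angle), at depth 1 AND depth 2.  THIS FILE does exactly that, by name over the tree's kernel-checked
Sect. C (`B7Eq92Concrete`, `B7Eq99Concrete`, `B7Eq84Concrete`): everything collapses by the GAUGE COVARIANCE of [3]'s constructions ((9), (11)∕(70),
(58)) and the telescoping of pure-gauge holonomies, and the only analysis is the series logarithm (21) of a scalar phase (`B8Ineq145Lineage.mlog_eI`).

## WHAT IS PROVED (kernel, 0 sorry; theorems only — NO `def`: the pure gauge is the tree's `gaugeAct g 1`, the block means are DISPLAYED sums)

Throughout `g x := eI (ψ x)` (`B8Ineq145Lineage.eI θ = e^{iθ} ∈ ℂˣ`), `U₁ := gaugeAct g 1` (= `mgauge 1 g 1`, [3] (55) at `V₀ = 1`: the bond variables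
`g(x)g(x+e_μ)⁻¹ = e^{i(ψ(x) − ψ(x+e_μ))}`), `U₀ := 1`; the block means are passed as functions `M₁`, `M₂` with their DEFINING sums displayed as hypotheses
(`M₁ z = Σ_{r∈[0,L)ᵈ} L^{−d}·ψ(Lz + r)`, `M₂ w = Σ_{s} L^{−d}·M₁(Lw + s)` — the uniform means over the 1-block `B¹(z)` and the 2-block `B²(w)`).
* §0 scalar phases: `eI_add`, `eI_neg`, `eI_sub`, `eI_zero'`, `norm_eI_sub_one'` (`‖e^{iφ} − 1‖ = 2|sin(φ∕2)|`), `sum_inv_card_box` (`Σ_r L^{−d} = 1`).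
* §1 pure gauges under [3]'s operations (any group ∕ Banach algebra, pure algebra): `hol_gaugeAct_one` ((9): `(dg)(Γ) = g(Γ₋)g(Γ₊)⁻¹`),
  `avgIter_gaugeAct_one` ((11)∕(43): `\overline{dg}^j = d(g∘Lʲ·)` — `B7Prop6Flat.avgIter_gaugeAct_units`), `tildIter_one_gaugeAct_one`, `tHol_one_gaugeAct_one`.
* §2 (78) on scalar phases: `Sexp_eI`, ★ `savg_eI` (`{e^{if}}_{B(y)} = e^{i·mean_B(y) f}` under `|f(x) − f(y)| < ln 2` on the block).
* §3 depth 1 and 2 on the pure gauge (`L ≥ 1`): ★ `wrec_one_pureGauge` ((82)∕(85): `w₁(z) = e^{i(ψ(Lz) − M₁ψ(z))}`), ★ `wrec_two_pureGauge` ((85):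
  `w₂(w) = e^{i(ψ(L²w) − M₂ψ(w))}`), ★ `glev_one_pureGauge` ((76)+(87), depth 1: `u(x) = e^{i(M₁ψ(⌊x∕L⌋) − ψ(x))}`), ★ `glev_two_pureGauge` ((76)–(77)+(87),
  depth 2: `u(x) = e^{i(M₂ψ(⌊x∕L²⌋) − ψ(x))}`) — i.e. on a pure gauge [3]'s depth-`J` gauge fixing is `g⁻¹` TIMES THE INVERSE OF THE TOWER MEAN of `g⁻¹`
  (the averaging condition (81) normalises each tower by its own mean, NOT by its value at the base point).
* §4 ★★ `mgauge_interTower_pureGauge`: for any gauge function `u` that is the depth-2 fixing at `x` and the depth-1 fixing at `x + e_μ` (as print's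
  tower-wise map is on a bond between a depth-2 tower and an adjacent depth-1 tower), the gauge-fixed bond variable is
  `(U₁)^u(x, x+e_μ) = e^{i(M₂ψ(⌊x∕L²⌋) − M₁ψ(⌊(x+e_μ)∕L⌋))}` — the difference of the two tower means of the potential, INDEPENDENT of the bond.

## HONEST SCOPE

Pure algebra plus the scalar series logarithm; NO estimate of [Balaban1985Averaging] or [Balaban1985RegularSpaces] is proved or asserted; the smallness
hypotheses (`< ln 2`) are displayed, not discharged (the consumer's potential obeys (1.140), which gives them).  The file says nothing about non-abelian
`𝔸` or curved `U₁`.  Count-neutral helper keyed `stmt-QuantumFields-20542` (K1⁷); N05 NOT discharged; no summit statement is proved by this seat — R4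
closes the conditional finite-`𝕋⁴` rung `BalabanLadder.UV` only; nothing continuum ∕ ℝ⁴ ∕ OS ∕ mass-gap ∕ Clay.  No `sorry`, no `def`, no `instance`,
no `notation`.  Unit `pub-ymgap-dag-n05-w5` (g3), 2026-08-28.

RELATED IN THE TREE, NOT DUPLICATED: `B8Ineq145Lineage` §§1–2 (r05: the CONSTANT configuration `cst (eI θ)` — the special case `ψ` linear with equal
slopes; its `eI`, `mlog_eI` USED), `B7Eq84Concrete` (`glev`, `glev_of_lt`, `glev_top`, USED), `B7Eq99Concrete` (`savg`, `Sexp`, `wrec`, USED),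
`B7Eq92Concrete` (`mgauge`, `tHol`, `tildIter`, USED), `B7Prop6Flat.avgIter_gaugeAct_units` (USED), `B7Prop3Flat` (`Favg`, `vframe`, USED).

[cite: Balaban1985Averaging, (8)–(9) pp.18–19, (42)–(43) pp.23–24, (55) p.27, (58) p.27, (70)–(71) p.29, (76)–(78) pp.29–30, (79)–(81) p.30, (82) p.30, (85) p.31, (87) p.31;
Balaban1985RegularSpaces, Prop. 7 p.100, (1.5)–(1.6) p.77]
-/

noncomputable section

open NormedSpace Finset

namespace Literature.MathematicalPhysics.QuantumFieldTheory.Balaban1983to89.B7GaugeFixingPureGauge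

open Complex (I)
open B7Prop1Explicit B7Prop2Explicit MatrixLog B7Eq92Concrete B7Eq99Concrete B7Eq84Concrete B7AvgGaugeCovariance
open B7Prop3Flat (Favg vframe)
open B7Prop6Flat (avgIter_gaugeAct_units)
open B8Ineq130 (fl hol_one)
open B8Eq115GaugeFixing (fl_smul fl_block)
open B8Ineq145Lineage (eI mlog_eI)

-- `Site` alone would resolve to the torus sites of `Setup.lean`; re-export the `ℤ^d` sites of `B7Prop1Explicit`.
export B7Prop1Explicit (Site)

variable {d : ℕ}

/-! ## §0 Scalar phases `e^{iθ} ∈ ℂˣ` and the uniform weights of a block -/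

section Phases

/-- `(e^{iθ} : ℂ) = exp(iθ)` (Banach-algebra exponential of the lineage). [folklore] -/
@[simp] private theorem val_eI' (θ : ℝ) : ((eI θ : ℂˣ) : ℂ) = exp (I * (θ : ℂ)) := rfl

/-- `(e^{iθ} : ℂ) = Complex.exp (iθ)`. [folklore] -/
private theorem val_eI_complex (θ : ℝ) : ((eI θ : ℂˣ) : ℂ) = Complex.exp (I * (θ : ℂ)) := by
  rw [val_eI', Complex.exp_eq_exp_ℂ]

/-- `e^{i(a+b)} = e^{ia}e^{ib}` (as units of `ℂ`) — the scalar model's instance of the multiplicativity (9) `U(Γ₁ ∪ Γ₂) = U(Γ₁)U(Γ₂)`.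
[cite: Balaban1985Averaging, (9) p.18 (bookkeeping: scalar phases)] -/
private theorem eI_add (a b : ℝ) : eI (a + b) = eI a * eI b := by
  apply Units.ext
  rw [Units.val_mul, val_eI_complex, val_eI_complex, val_eI_complex, ← Complex.exp_add]
  push_cast
  ring_nf

/-- `e^{i·0} = 1`. [folklore] -/
@[simp] private theorem eI_zero' : eI 0 = 1 := by
  apply Units.ext
  rw [val_eI_complex, Units.val_one]
  simp

/-- `e^{−ia} = (e^{ia})⁻¹` (as units of `ℂ`) — the scalar model's instance of (9) `U(−b) = U(b)⁻¹`.
[cite: Balaban1985Averaging, (9) p.18 (bookkeeping: scalar phases)] -/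
private theorem eI_neg (a : ℝ) : eI (-a) = (eI a)⁻¹ := by
  rw [eq_inv_iff_mul_eq_one, ← eI_add, neg_add_cancel, eI_zero']

/-- `e^{i(a−b)} = e^{ia}(e^{ib})⁻¹` — the bond variable (8) of the scalar pure gauge `g = e^{iψ}`: `g(x)g(x+e_μ)⁻¹ = e^{i(ψ(x) − ψ(x+e_μ))}`.
[cite: Balaban1985Averaging, (8)–(9) pp.18–19 (bookkeeping: scalar phases)] -/
theorem eI_sub (a b : ℝ) : eI (a - b) = eI a * (eI b)⁻¹ := by
  rw [sub_eq_add_neg, eI_add, eI_neg]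

/-- `e^{ia}(e^{ib})⁻¹ = e^{i(a−b)}` — read right to left on the telescoped pure-gauge holonomies (9) `g(Γ₋)g(Γ₊)⁻¹`, `g = e^{iψ}`.
[cite: Balaban1985Averaging, (9) p.18 (bookkeeping: scalar phases)] -/
theorem eI_mul_eI_inv (a b : ℝ) : eI a * (eI b)⁻¹ = eI (a - b) := (eI_sub a b).symm

/-- `expUnit (i·t) = e^{it}` (definitional). [folklore] -/
private theorem expUnit_I_mul (t : ℝ) : expUnit (I * (t : ℂ)) = eI t := rfl

/-- `‖e^{iφ} − 1‖ = 2|sin(φ∕2)|` — the size of a scalar phase jump, the form in which every member of [Balaban1985RegularSpaces] (1.145) is read on the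
abelian witnesses of the lineage. [cite: Balaban1985RegularSpaces, (1.145) p.100 (bookkeeping: scalar phases)] -/
theorem norm_eI_sub_one' (φ : ℝ) : ‖((eI φ : ℂˣ) : ℂ) - 1‖ = 2 * |Real.sin (φ / 2)| := by
  rw [val_eI_complex, Complex.norm_exp_I_mul_ofReal_sub_one, Real.norm_eq_abs, abs_mul, abs_two]

/-- The uniform weights of a block sum to one: `Σ_{r ∈ [0,L)ᵈ} L^{−d} = 1` (`L ≥ 1`). [cite: Balaban1985Averaging, (42) p.23 («Σ_{x∈B(y)} L^{−d}»)] -/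
theorem sum_inv_card_box {L : ℕ} (hL : 1 ≤ L) : ∑ _r : Fin d → Fin L, ((L : ℝ) ^ d)⁻¹ = 1 := by
  rw [Finset.sum_const, Finset.card_univ, Fintype.card_fun, Fintype.card_fin, Fintype.card_fin, nsmul_eq_mul]
  push_cast
  have : (L : ℝ) ^ d ≠ 0 := pow_ne_zero _ (by exact_mod_cast (show L ≠ 0 by omega))
  field_simp

/-- A block mean of a difference `f(y+r) − f(y)`: `Σ_r L^{−d}(f(y+r) − f(y)) = (Σ_r L^{−d} f(y+r)) − f(y)` — the exponent of (78) for an abelian field is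
«mean minus centre value». [cite: Balaban1985Averaging, (78) p.30 (bookkeeping: uniform block weights)] -/
theorem sum_inv_card_mul_sub {L : ℕ} (hL : 1 ≤ L) (f : Site d → ℝ) (y : Site d) :
    ∑ r : Fin d → Fin L, ((L : ℝ) ^ d)⁻¹ * (f (y + boxVec L r) - f y)
      = (∑ r : Fin d → Fin L, ((L : ℝ) ^ d)⁻¹ * f (y + boxVec L r)) - f y := by
  simp only [mul_sub, Finset.sum_sub_distrib, ← Finset.sum_mul, sum_inv_card_box hL, one_mul]

end Phases

/-! ## §1 Pure gauges `dg := g·1·g⁻¹` under [3]'s operations (pure algebra) -/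

section PureGauge

variable {G : Type*} [Group G]

/-- **(9) on a pure gauge**: `(dg)(Γ) = g(Γ₋)·g(Γ₊)⁻¹` — the holonomy of `gaugeAct g 1` along any word telescopes (`hol_gaugeAct`, `hol_one`).
[cite: Balaban1985Averaging, (8)–(9) pp.18–19] -/
theorem hol_gaugeAct_one (g : Site d → G) (y : Site d) (w : List (Letter d)) :
    hol (gaugeAct g (1 : Site d → Fin d → G)) y w = g y * (g (y + disp w))⁻¹ := by
  rw [hol_gaugeAct, hol_one, mul_one]

/-- The bond variable of a pure gauge: `(dg)(x, x+e_μ) = g(x)g(x+e_μ)⁻¹`. [cite: Balaban1985Averaging, (8) p.18] -/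
theorem gaugeAct_one_apply (g : Site d → G) (x : Site d) (μ : Fin d) :
    gaugeAct g (1 : Site d → Fin d → G) x μ = g x * (g (x + e μ))⁻¹ := by
  simp [gaugeAct]

/-- (58) at `U₀ = 1` on a pure gauge: the twisted transport is `g(Γ₋)g(Γ₊)⁻¹`. [cite: Balaban1985Averaging, (58) p.27, (9) p.18] -/
theorem tHol_one_gaugeAct_one (g : Site d → G) (y : Site d) (w : List (Letter d)) :
    tHol (1 : Site d → Fin d → G) (gaugeAct g 1) y w = g y * (g (y + disp w))⁻¹ := by
  rw [tHol_one_left, hol_gaugeAct_one]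

variable {𝔸 : Type*} [NormedRing 𝔸] [NormedAlgebra ℂ 𝔸] [CompleteSpace 𝔸]

/-- **(11)∕(43) on a pure gauge**: `\overline{dg}^j = d(g∘Lʲ·)` — the `j`-fold average of a pure gauge is the pure gauge of `g` sampled on the level-`j`
lattice (`B7Prop6Flat.avgIter_gaugeAct_units` + `avgIter_one`; exact, no smallness). [cite: Balaban1985Averaging, (11) p.19, (43) p.24] -/
theorem avgIter_gaugeAct_one (L : ℕ) (g : Site d → 𝔸ˣ) (j : ℕ) :
    avgIter L (gaugeAct g (1 : Site d → Fin d → 𝔸ˣ)) j = gaugeAct (uLev L g j) 1 := by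
  rw [avgIter_gaugeAct_units, avgIter_one]

/-- (69)∕(71) at `U₀ = 1` on a pure gauge: `\widetilde{dg}^j = d(g∘Lʲ·)`. [cite: Balaban1985Averaging, (69)–(71) p.29] -/
theorem tildIter_one_gaugeAct_one (L : ℕ) (g : Site d → 𝔸ˣ) (j : ℕ) :
    tildIter L (1 : Site d → Fin d → 𝔸ˣ) (gaugeAct g 1) j = gaugeAct (uLev L g j) 1 := by
  rw [tildIter_one_left, avgIter_gaugeAct_one]

/-- **The scalar pure gauge IS a small-field exponential `U₁ = e^{iηA}`** ([Balaban1985RegularSpaces] p. 100: «U₁ = e^{iηA}»): with the Lie-algebra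
configuration `A(x, x+e_μ) := (ψ(x) − ψ(x+e_μ))∕η` (the lattice derivative of the potential, any `η ≠ 0`), `cfgExp η A = g·1·g⁻¹`, `g = e^{iψ}`.
[cite: Balaban1985RegularSpaces, p.100 («U₁ = e^{iηA}»); Balaban1985Averaging, (8) p.18] -/
theorem cfgExp_potential_eq_gaugeAct {η : ℝ} (hη : η ≠ 0) (ψ : Site d → ℝ) :
    B8Eq184Proof.cfgExp η (fun y τ => ((((ψ y - ψ (y + e τ)) / η : ℝ)) : ℂ)) = gaugeAct (fun x => eI (ψ x)) (1 : Site d → Fin d → ℂˣ) := by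
  funext y τ
  rw [gaugeAct_one_apply, eI_mul_eI_inv, B8Eq184Proof.cfgExp, ← expUnit_I_mul, smul_eq_mul, Complex.real_smul]
  have hη' : (η : ℂ) ≠ 0 := by exact_mod_cast hη
  push_cast
  rw [mul_div_cancel₀ _ hη']

end PureGauge

/-! ## §2 The site average (78) of a scalar phase field -/

section SiteAverage

variable (L : ℕ)

/-- **The exponent of (78) for `x ↦ e^{if(x)}`**: `S(y) = Σ_{r} L^{−d}·log(e^{−if(y)}e^{if(y+r)}) = i·Σ_r L^{−d}(f(y+r) − f(y))` — every logarithm is the series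
logarithm (21), which needs `|f(y+r) − f(y)| < ln 2`. [cite: Balaban1985Averaging, (78) p.30, (21) p.21] -/
theorem Sexp_eI (f : Site d → ℝ) (y : Site d) (hf : ∀ r : Fin d → Fin L, |f (y + boxVec L r) - f y| < Real.log 2) :
    Sexp L (fun x => eI (f x)) y = I * ((∑ r : Fin d → Fin L, ((L : ℝ) ^ d)⁻¹ * (f (y + boxVec L r) - f y) : ℝ) : ℂ) := by
  rw [Sexp_apply]
  have hterm : ∀ r : Fin d → Fin L,
      mlog ((((eI (f y))⁻¹ * eI (f (y + boxVec L r)) : ℂˣ)) : ℂ) = I * (((f (y + boxVec L r) - f y : ℝ)) : ℂ) := by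
    intro r
    rw [← eI_neg, ← eI_add, neg_add_eq_sub, mlog_eI _ (hf r)]
  simp_rw [hterm, Complex.real_smul]
  push_cast
  rw [Finset.mul_sum]
  exact Finset.sum_congr rfl fun r _ => by ring

/-- ★ **(78) of a scalar phase field is the phase of the block MEAN**: `{e^{if}}_{B(y)} = e^{if(y)}·exp(i·Σ_r L^{−d}(f(y+r) − f(y))) = e^{i·Σ_r L^{−d} f(y+r)}`
(`L ≥ 1`; smallness `|f(y+r) − f(y)| < ln 2` on the block). [cite: Balaban1985Averaging, (78) p.30] -/
theorem savg_eI (hL : 1 ≤ L) (f : Site d → ℝ) (y : Site d) (hf : ∀ r : Fin d → Fin L, |f (y + boxVec L r) - f y| < Real.log 2) :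
    savg L (fun x => eI (f x)) y = eI (∑ r : Fin d → Fin L, ((L : ℝ) ^ d)⁻¹ * f (y + boxVec L r)) := by
  rw [savg_apply, Sexp_eI L f y hf, expUnit_I_mul, ← eI_add, sum_inv_card_mul_sub hL]
  congr 1
  ring

end SiteAverage

/-! ## §3 [3]'s frames (85) and gauge fixings (76)–(77)+(87) of depth 1 and 2 on a pure gauge `g = e^{iψ}`, `U₀ = 1` -/

section DepthOneTwo

/-- ★ **THE DEPTH-1 FRAME (82)∕(85) of a pure gauge**: `w₁(z) = \overline{R_{0,Lz}(dg)} = exp(Σ_r L^{−d} log e^{i(ψ(Lz) − ψ(Lz+r))}) = e^{i(ψ(Lz) − M₁ψ(z))}`,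
`M₁ψ(z) = Σ_r L^{−d}ψ(Lz + r)` the mean of the potential over the 1-block `B¹(z)` (smallness: `|ψ(Lz+r) − ψ(Lz)| < ln 2` on the block).
[cite: Balaban1985Averaging, (82) p.30, (85) p.31, (110) p.34] -/
theorem wrec_one_pureGauge (L : ℕ) (hL : 1 ≤ L) (ψ M₁ : Site d → ℝ)
    (hM₁ : ∀ z : Site d, M₁ z = ∑ r : Fin d → Fin L, ((L : ℝ) ^ d)⁻¹ * ψ ((L : ℤ) • z + boxVec L r))
    (z : Site d) (hψ : ∀ r : Fin d → Fin L, |ψ ((L : ℤ) • z + boxVec L r) - ψ ((L : ℤ) • z)| < Real.log 2) :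
    wrec L (1 : Site d → Fin d → ℂˣ) (gaugeAct (fun x => eI (ψ x)) 1) 1 z = eI (ψ ((L : ℤ) • z) - M₁ z) := by
  rw [wrec_one, wframe_one_left]
  apply Units.ext
  rw [vframe, val_expUnit]
  have hF : Favg L (gaugeAct (fun x => eI (ψ x)) (1 : Site d → Fin d → ℂˣ)) ((L : ℤ) • z)
      = I * (((ψ ((L : ℤ) • z) - M₁ z : ℝ)) : ℂ) := by
    unfold Favg
    have hterm : ∀ r : Fin d → Fin L,
        mlog ((hol (gaugeAct (fun x => eI (ψ x)) (1 : Site d → Fin d → ℂˣ)) ((L : ℤ) • z) (treeWord (boxVec L r)) : ℂˣ) : ℂ)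
          = I * (((ψ ((L : ℤ) • z) - ψ ((L : ℤ) • z + boxVec L r) : ℝ)) : ℂ) := by
      intro r
      rw [hol_gaugeAct_one, disp_treeWord, eI_mul_eI_inv, mlog_eI]
      rw [abs_sub_comm]; exact hψ r
    simp_rw [hterm, Complex.real_smul]
    have hsum : ∑ r : Fin d → Fin L, ((L : ℝ) ^ d)⁻¹ * (ψ ((L : ℤ) • z) - ψ ((L : ℤ) • z + boxVec L r)) = ψ ((L : ℤ) • z) - M₁ z := by
      rw [hM₁ z]
      simp only [mul_sub, Finset.sum_sub_distrib, ← Finset.sum_mul, sum_inv_card_box hL, one_mul]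
    rw [← hsum]
    push_cast
    rw [Finset.mul_sum]
    exact Finset.sum_congr rfl fun r _ => by ring
  rw [hF, ← val_eI']

/-- ★ **THE DEPTH-2 FRAME (85) of a pure gauge**: `w₂(w) = \overline{R_{0,L²w}(dg)}^{(2)} = e^{i(ψ(L²w) − M₂ψ(w))}`, `M₂ψ(w) = Σ_s L^{−d} M₁ψ(Lw + s)` the mean of the
potential over the 2-block `B²(w)` — (85) unfolded: the site average (78) over the level-1 block of `w` of `x ↦ \overline{dg}¹(Γ_{Lw,x})·w₁(x)`, where
`\overline{dg}¹ = d(g∘L·)` (§1) telescopes to `e^{i(ψ(L²w) − ψ(Lx))}` and `w₁(x) = e^{i(ψ(Lx) − M₁ψ(x))}` (smallness on both scales displayed).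
[cite: Balaban1985Averaging, (85) p.31, (78) p.30, (43) p.24] -/
theorem wrec_two_pureGauge (L : ℕ) (hL : 1 ≤ L) (ψ M₁ M₂ : Site d → ℝ)
    (hM₁ : ∀ z : Site d, M₁ z = ∑ r : Fin d → Fin L, ((L : ℝ) ^ d)⁻¹ * ψ ((L : ℤ) • z + boxVec L r))
    (hM₂ : ∀ w : Site d, M₂ w = ∑ s : Fin d → Fin L, ((L : ℝ) ^ d)⁻¹ * M₁ ((L : ℤ) • w + boxVec L s)) (w : Site d)
    (hψ : ∀ (s r : Fin d → Fin L), |ψ ((L : ℤ) • ((L : ℤ) • w + boxVec L s) + boxVec L r) - ψ ((L : ℤ) • ((L : ℤ) • w + boxVec L s))| < Real.log 2)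
    (hM : ∀ s : Fin d → Fin L, |M₁ ((L : ℤ) • w + boxVec L s) - M₁ ((L : ℤ) • w)| < Real.log 2) :
    wrec L (1 : Site d → Fin d → ℂˣ) (gaugeAct (fun x => eI (ψ x)) 1) 2 w = eI (ψ ((L : ℤ) • ((L : ℤ) • w)) - M₂ w) := by
  rw [wrec_succ, avgIter_one, tildIter_one_gaugeAct_one, R0fun_one_left]
  have hfun : (fun x => tHol (1 : Site d → Fin d → ℂˣ) (gaugeAct (uLev L (fun x => eI (ψ x)) 1) 1) ((L : ℤ) • w)
        (treeWord (x - (L : ℤ) • w)) * wrec L (1 : Site d → Fin d → ℂˣ) (gaugeAct (fun x => eI (ψ x)) 1) 1 x)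
      = fun x => eI (ψ ((L : ℤ) • ((L : ℤ) • w)) - ψ ((L : ℤ) • x)) * wrec L (1 : Site d → Fin d → ℂˣ) (gaugeAct (fun x => eI (ψ x)) 1) 1 x := by
    funext x
    rw [tHol_one_gaugeAct_one, disp_treeWord, add_sub_cancel, uLev_apply, uLev_apply, pow_one, eI_mul_eI_inv]
  rw [hfun]
  -- on the block of `Lw` the depth-1 frame is in closed form, so the averaged function is `x ↦ e^{i(ψ(L²w) − M₁ψ(x))}`
  have hcongr : savg L (fun x => eI (ψ ((L : ℤ) • ((L : ℤ) • w)) - ψ ((L : ℤ) • x))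
          * wrec L (1 : Site d → Fin d → ℂˣ) (gaugeAct (fun x => eI (ψ x)) 1) 1 x) ((L : ℤ) • w)
      = savg L (fun x => eI (ψ ((L : ℤ) • ((L : ℤ) • w)) - M₁ x)) ((L : ℤ) • w) := by
    apply savg_congr
    · rw [wrec_one_pureGauge L hL ψ M₁ hM₁ ((L : ℤ) • w) (by simpa using hψ (B7Eq84Concrete.bzero hL)), ← eI_add]
      congr 1; ring
    · intro s
      rw [wrec_one_pureGauge L hL ψ M₁ hM₁ ((L : ℤ) • w + boxVec L s) (hψ s), ← eI_add]
      congr 1; ring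
  rw [hcongr, savg_eI L hL _ _ (fun s => by rw [sub_sub_sub_cancel_left, abs_sub_comm]; exact hM s)]
  congr 1
  rw [hM₂ w]
  simp only [mul_sub, Finset.sum_sub_distrib, ← Finset.sum_mul, sum_inv_card_box hL, one_mul]

/-- ★ **[3]'s DEPTH-1 GAUGE FIXING of a pure gauge** ((76) below the values (87), `k = 1`): `glev₁(x) = w₁(⌊x∕L⌋)⁻¹·(dg)(Γ_{L⌊x∕L⌋, x}) = e^{i(M₁ψ(⌊x∕L⌋) − ψ(x))}`
— `g(x)⁻¹` times the inverse of the BLOCK MEAN of `g⁻¹` (the averaging condition (81) normalises the block mean of `u`, not its value at the base point).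
[cite: Balaban1985Averaging, (76) p.29, (87) p.31, (81) p.30] -/
theorem glev_one_pureGauge (L : ℕ) (hL : 1 ≤ L) (ψ M₁ : Site d → ℝ)
    (hM₁ : ∀ z : Site d, M₁ z = ∑ r : Fin d → Fin L, ((L : ℝ) ^ d)⁻¹ * ψ ((L : ℤ) • z + boxVec L r)) (x : Site d)
    (hψ : ∀ r : Fin d → Fin L, |ψ ((L : ℤ) • fl L x + boxVec L r) - ψ ((L : ℤ) • fl L x)| < Real.log 2) :
    glev L hL (1 : Site d → Fin d → ℂˣ) (gaugeAct (fun x => eI (ψ x)) 1) 1 0 x = eI (M₁ (fl L x) - ψ x) := by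
  rw [glev_of_lt L hL _ _ Nat.zero_lt_one, avgIter_zero, hol_one, inv_one, Rc_one_apply, glev_top, tildIter_zero', tHol_one_left,
    hol_gaugeAct_one, disp_treeWord, fl_decomp hL x, wrec_one_pureGauge L hL ψ M₁ hM₁ (fl L x) hψ, ← eI_neg, eI_mul_eI_inv, ← eI_add]
  congr 1; ring

/-- ★ **[3]'s DEPTH-2 GAUGE FIXING of a pure gauge** ((76)–(77) below the values (87), `k = 2`):
`glev₂(x) = w₂(⌊x∕L²⌋)⁻¹·\overline{dg}¹(Γ^{(1)})·(dg)(Γ) = e^{i(M₂ψ(⌊⌊x∕L⌋∕L⌋) − ψ(x))}` — `g(x)⁻¹` times the inverse of the 2-BLOCK MEAN of `g⁻¹`.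
[cite: Balaban1985Averaging, (76)–(77) pp.29–30, (87) p.31, (81) p.30] -/
theorem glev_two_pureGauge (L : ℕ) (hL : 1 ≤ L) (ψ M₁ M₂ : Site d → ℝ)
    (hM₁ : ∀ z : Site d, M₁ z = ∑ r : Fin d → Fin L, ((L : ℝ) ^ d)⁻¹ * ψ ((L : ℤ) • z + boxVec L r))
    (hM₂ : ∀ w : Site d, M₂ w = ∑ s : Fin d → Fin L, ((L : ℝ) ^ d)⁻¹ * M₁ ((L : ℤ) • w + boxVec L s)) (x : Site d)
    (hψ : ∀ (s r : Fin d → Fin L), |ψ ((L : ℤ) • ((L : ℤ) • fl L (fl L x) + boxVec L s) + boxVec L r) - ψ ((L : ℤ) • ((L : ℤ) • fl L (fl L x) + boxVec L s))|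
      < Real.log 2)
    (hM : ∀ s : Fin d → Fin L, |M₁ ((L : ℤ) • fl L (fl L x) + boxVec L s) - M₁ ((L : ℤ) • fl L (fl L x))| < Real.log 2) :
    glev L hL (1 : Site d → Fin d → ℂˣ) (gaugeAct (fun x => eI (ψ x)) 1) 2 0 x = eI (M₂ (fl L (fl L x)) - ψ x) := by
  -- level 0 → level 1: (76) at `j = 0`
  rw [glev_of_lt L hL _ _ Nat.zero_lt_two, avgIter_zero, hol_one, inv_one, Rc_one_apply, tildIter_zero', tHol_one_left, hol_gaugeAct_one,
    disp_treeWord, fl_decomp hL x]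
  -- level 1 → level 2: (76) at `j = 1` below the values (87)
  rw [glev_of_lt L hL _ _ Nat.one_lt_two, avgIter_one, hol_one, inv_one, Rc_one_apply, glev_top, tildIter_one_gaugeAct_one,
    tHol_one_gaugeAct_one, disp_treeWord, uLev_apply, uLev_apply, pow_one, fl_decomp hL (fl L x),
    wrec_two_pureGauge L hL ψ M₁ M₂ hM₁ hM₂ (fl L (fl L x)) hψ hM, ← eI_neg, eI_mul_eI_inv, eI_mul_eI_inv, ← eI_add, ← eI_add]
  congr 1; ring

end DepthOneTwo

/-! ## §4 The transition function of the gauge-fixed pure gauge between a depth-2 tower and a depth-1 tower -/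

section Transition

/-- ★★ **THE INTER-TOWER TRANSITION FUNCTION**: let `u` be any gauge function which at the site `x` is [3]'s DEPTH-2 gauge fixing of the pure gauge
`U₁ = dg`, `g = e^{iψ}` (as print's tower-wise map is on a tower of depth 2) and at `x + e_μ` its DEPTH-1 gauge fixing (as on an adjacent tower of depth 1);
then the gauge-fixed bond variable (55) at `U₀ = 1` is `u(x)·g(x)g(x+e_μ)⁻¹·u(x+e_μ)⁻¹ = e^{i(M₂ψ(⌊x∕L²⌋) − M₁ψ(⌊(x+e_μ)∕L⌋))}` — the difference of the
MEANS of the potential over the two towers; the bond's own variable cancels.  (For two towers of the SAME depth `j` this is [3]'s (88)∕(92)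
`Ũ′ʲ = U̿₁ʲ`; across depths it is not of that form — the located mechanism behind the box-form failure of [Balaban1985RegularSpaces] (1.145) at
constant `2`, `B8Prop7PrintedRZdGF3BoxFormInterTower`.) [cite: Balaban1985Averaging, (55) p.27, (76)–(77) pp.29–30, (87) p.31, (88) p.31; Balaban1985RegularSpaces, Prop. 7 (1.145) p.100] -/
theorem mgauge_interTower_pureGauge (L : ℕ) (hL : 1 ≤ L) (ψ M₁ M₂ : Site d → ℝ)
    (hM₁ : ∀ z : Site d, M₁ z = ∑ r : Fin d → Fin L, ((L : ℝ) ^ d)⁻¹ * ψ ((L : ℤ) • z + boxVec L r))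
    (hM₂ : ∀ w : Site d, M₂ w = ∑ s : Fin d → Fin L, ((L : ℝ) ^ d)⁻¹ * M₁ ((L : ℤ) • w + boxVec L s))
    (u : Site d → ℂˣ) (x : Site d) (μ : Fin d)
    (hux : u x = glev L hL (1 : Site d → Fin d → ℂˣ) (gaugeAct (fun x => eI (ψ x)) 1) 2 0 x)
    (huxe : u (x + e μ) = glev L hL (1 : Site d → Fin d → ℂˣ) (gaugeAct (fun x => eI (ψ x)) 1) 1 0 (x + e μ))
    (hψ2 : ∀ (s r : Fin d → Fin L), |ψ ((L : ℤ) • ((L : ℤ) • fl L (fl L x) + boxVec L s) + boxVec L r) - ψ ((L : ℤ) • ((L : ℤ) • fl L (fl L x) + boxVec L s))|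
      < Real.log 2)
    (hM2 : ∀ s : Fin d → Fin L, |M₁ ((L : ℤ) • fl L (fl L x) + boxVec L s) - M₁ ((L : ℤ) • fl L (fl L x))| < Real.log 2)
    (hψ1 : ∀ r : Fin d → Fin L, |ψ ((L : ℤ) • fl L (x + e μ) + boxVec L r) - ψ ((L : ℤ) • fl L (x + e μ))| < Real.log 2) :
    mgauge (1 : Site d → Fin d → ℂˣ) u (gaugeAct (fun x => eI (ψ x)) 1) x μ = eI (M₂ (fl L (fl L x)) - M₁ (fl L (x + e μ))) := by
  rw [mgauge_apply, Pi.one_apply, Pi.one_apply, Rc_one_apply, hux, huxe, gaugeAct_one_apply,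
    glev_two_pureGauge L hL ψ M₁ M₂ hM₁ hM₂ x hψ2 hM2, glev_one_pureGauge L hL ψ M₁ hM₁ (x + e μ) hψ1,
    eI_mul_eI_inv, ← eI_add, eI_mul_eI_inv]
  congr 1; ring

/-- The same read as the value of the transformed field `(U₁^u·U₀)(x, x+e_μ)` at `U₀ = 1` and its distance to `U₀ = 1`:
`‖(U₁^u·1)(x,μ) − 1‖ = 2|sin((M₂ψ − M₁ψ)∕2)|` — the left member of the box-form (1.145) at level `0` on that bond.
[cite: Balaban1985RegularSpaces, Prop. 7 (1.145) p.100; Balaban1985Averaging, (55) p.27] -/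
theorem norm_mgauge_interTower_sub_one (L : ℕ) (hL : 1 ≤ L) (ψ M₁ M₂ : Site d → ℝ)
    (hM₁ : ∀ z : Site d, M₁ z = ∑ r : Fin d → Fin L, ((L : ℝ) ^ d)⁻¹ * ψ ((L : ℤ) • z + boxVec L r))
    (hM₂ : ∀ w : Site d, M₂ w = ∑ s : Fin d → Fin L, ((L : ℝ) ^ d)⁻¹ * M₁ ((L : ℤ) • w + boxVec L s))
    (u : Site d → ℂˣ) (x : Site d) (μ : Fin d)
    (hux : u x = glev L hL (1 : Site d → Fin d → ℂˣ) (gaugeAct (fun x => eI (ψ x)) 1) 2 0 x)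
    (huxe : u (x + e μ) = glev L hL (1 : Site d → Fin d → ℂˣ) (gaugeAct (fun x => eI (ψ x)) 1) 1 0 (x + e μ))
    (hψ2 : ∀ (s r : Fin d → Fin L), |ψ ((L : ℤ) • ((L : ℤ) • fl L (fl L x) + boxVec L s) + boxVec L r) - ψ ((L : ℤ) • ((L : ℤ) • fl L (fl L x) + boxVec L s))|
      < Real.log 2)
    (hM2 : ∀ s : Fin d → Fin L, |M₁ ((L : ℤ) • fl L (fl L x) + boxVec L s) - M₁ ((L : ℤ) • fl L (fl L x))| < Real.log 2)
    (hψ1 : ∀ r : Fin d → Fin L, |ψ ((L : ℤ) • fl L (x + e μ) + boxVec L r) - ψ ((L : ℤ) • fl L (x + e μ))| < Real.log 2) :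
    ‖(((mgauge (1 : Site d → Fin d → ℂˣ) u (gaugeAct (fun x => eI (ψ x)) 1) * (1 : Site d → Fin d → ℂˣ)) x μ : ℂˣ) : ℂ)
        - (((1 : Site d → Fin d → ℂˣ) x μ : ℂˣ) : ℂ)‖
      = 2 * |Real.sin ((M₂ (fl L (fl L x)) - M₁ (fl L (x + e μ))) / 2)| := by
  rw [Pi.mul_apply, Pi.one_apply, mul_one, mgauge_interTower_pureGauge L hL ψ M₁ M₂ hM₁ hM₂ u x μ hux huxe hψ2 hM2 hψ1, Pi.one_apply,
    Units.val_one, norm_eI_sub_one']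

end Transition

end Literature.MathematicalPhysics.QuantumFieldTheory.Balaban1983to89.B7GaugeFixingPureGauge

end
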